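import Mathlib.NumberTheory.Padics.Hensel
import Mathlib.NumberTheory.Padics.RingHoms
import Mathlib.RingTheory.Ideal.Norm.AbsNorm
import Literature.NumberTheory.NumberFields.CubicFieldExplicit
import Summits.BirchSwinnertonDyer.BirchSwinnertonDyer.Theorems.Rank2Observatory2DescLinGens
import Summits.BirchSwinnertonDyer.BirchSwinnertonDyer.Theorems.Rank2Observatory2DescPadicRoot
import HarnessLib

/-!
# KERNEL-2DESC-CL, `p`-adic ROOT VIEW (part D2): membership of `X(θ)/m` in the prime of a certified root

HONEST FRAMING: per-curve certified theorems and census instruments; no claim on BSD in rank ≥ 2.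

Part D1 (`Rank2Observatory2DescPadicRoot`) certifies a simple root `z ∈ ℤ_p` of the cubic with
`‖z - a‖ ≤ p^(-N)`, the embedding `φ : K → ℚ_p`, `θ ↦ z`, and the degree-one prime `P_φ = {x : ‖φ x‖ < 1}`.
Here: for an algebraic integer `x` presented as `m·x = X₀ + X₁θ + X₂θ²` (the presentation every field /
curve record of the observatory uses), membership and non-membership in `P_φ` are read from integers:

* `memCheck`:    `v + 1 ≤ N`, `p^(v+1) ∤ m`, `p^(v+1) ∣ X(a)`  ⟹  `x ∈ P_φ`   (`mem_primeOf_of_memCheck`);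
* `notMemCheck`: `v + 1 ≤ N`, `p^v ∣ m`,     `p^(v+1) ∤ X(a)`  ⟹  `x ∉ P_φ`   (`not_mem_primeOf_of_notMemCheck`).

(`X(z) ≡ X(a) mod p^N` because `X` has integer coefficients; then compare `‖X(z)‖` with `‖m‖`.) [folklore]
-/

noncomputable section

set_option linter.dupNamespace false

open Polynomial NumberField Literature.NumberTheory.NumberFields

namespace Summit.BirchSwinnertonDyer.BirchSwinnertonDyer.Rank2Observatory.TwoDescPadic

/-- `X(a) = X₀ + X₁a + X₂a²`. -/
def quadEval (X₀ X₁ X₂ a : ℤ) : ℤ := X₀ + X₁ * a + X₂ * a ^ 2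

/-- **Membership certificate** for `x = X(θ)/m` in the prime of a root `≡ a (mod p^N)`. [folklore] -/
def memCheck (p : ℕ) (a : ℤ) (N : ℕ) (m : ℤ) (v : ℕ) (X₀ X₁ X₂ : ℤ) : Bool :=
  decide (v + 1 ≤ N) && !decide (((p : ℤ) ^ (v + 1)) ∣ m) && decide (((p : ℤ) ^ (v + 1)) ∣ quadEval X₀ X₁ X₂ a)

/-- **Non-membership certificate** for `x = X(θ)/m` in the prime of a root `≡ a (mod p^N)`. [folklore] -/
def notMemCheck (p : ℕ) (a : ℤ) (N : ℕ) (m : ℤ) (v : ℕ) (X₀ X₁ X₂ : ℤ) : Bool :=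
  decide (v + 1 ≤ N) && decide (((p : ℤ) ^ v) ∣ m) && !decide (((p : ℤ) ^ (v + 1)) ∣ quadEval X₀ X₁ X₂ a)

section Mem

variable {K : Type*} [Field K] [NumberField K] {A B C : ℤ} {θ : K} {p : ℕ} [hp : Fact p.Prime]

/-- `φ(X(θ)) = X(z)` in `ℚ_p`. -/
theorem emb_lin (hθ : aeval θ (MonicCubic.poly A B C) = 0) (φ : K →+* ℚ_[p]) {z : ℤ_[p]}
    (hφ : φ θ = (z : ℚ_[p])) (X₀ X₁ X₂ : ℤ) :
    φ ((TwoDescCubic.lin hθ X₀ X₁ X₂ : 𝓞 K) : K) =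
      (((X₀ : ℤ_[p]) + (X₁ : ℤ_[p]) * z + (X₂ : ℤ_[p]) * z ^ 2 : ℤ_[p]) : ℚ_[p]) := by
  rw [TwoDescCubic.lin_coe]
  simp [hφ]

/-- `X(z) - X(a) = (z - a)(X₁ + X₂(z + a))`: integer polynomials are `1`-Lipschitz on `ℤ_p`. -/
theorem norm_quad_sub_le (z : ℤ_[p]) (a X₀ X₁ X₂ : ℤ) :
    ‖((X₀ : ℤ_[p]) + (X₁ : ℤ_[p]) * z + (X₂ : ℤ_[p]) * z ^ 2) - ((quadEval X₀ X₁ X₂ a : ℤ) : ℤ_[p])‖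
      ≤ ‖z - (a : ℤ_[p])‖ := by
  have hfac : ((X₀ : ℤ_[p]) + (X₁ : ℤ_[p]) * z + (X₂ : ℤ_[p]) * z ^ 2) - ((quadEval X₀ X₁ X₂ a : ℤ) : ℤ_[p])
      = (z - (a : ℤ_[p])) * ((X₁ : ℤ_[p]) + (X₂ : ℤ_[p]) * (z + (a : ℤ_[p]))) := by
    simp only [quadEval]; push_cast; ring
  rw [hfac, norm_mul]
  exact mul_le_of_le_one_right (norm_nonneg _) (PadicInt.norm_le_one _)

/-- From `m·x = X(θ)`: `(m : ℚ_p) · φ x = X(z)`. -/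
theorem emb_mul_eq (hθ : aeval θ (MonicCubic.poly A B C) = 0) (φ : K →+* ℚ_[p]) {z : ℤ_[p]}
    (hφ : φ θ = (z : ℚ_[p])) {m X₀ X₁ X₂ : ℤ} {x : 𝓞 K}
    (hx : (m : 𝓞 K) * x = TwoDescCubic.lin hθ X₀ X₁ X₂) :
    (m : ℚ_[p]) * φ x = (((X₀ : ℤ_[p]) + (X₁ : ℤ_[p]) * z + (X₂ : ℤ_[p]) * z ^ 2 : ℤ_[p]) : ℚ_[p]) := by
  have h := congrArg (fun y : 𝓞 K => φ (y : K)) hx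
  simp only [map_mul, map_intCast, RingOfIntegers.coe_eq_algebraMap] at h
  rw [← emb_lin hθ φ hφ, RingOfIntegers.coe_eq_algebraMap, ← h]

/-- **Membership** `x ∈ P_φ` from the certificate. [folklore] -/
theorem mem_primeOf_of_memCheck (hθ : aeval θ (MonicCubic.poly A B C) = 0) (φ : K →+* ℚ_[p])
    {z : ℤ_[p]} (hφ : φ θ = (z : ℚ_[p])) {a : ℤ} {N : ℕ} (hza : ‖z - (a : ℤ_[p])‖ ≤ (p : ℝ) ^ (-(N : ℤ)))
    {m : ℤ} {v : ℕ} {X₀ X₁ X₂ : ℤ} {x : 𝓞 K} (hx : (m : 𝓞 K) * x = TwoDescCubic.lin hθ X₀ X₁ X₂)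
    (hc : memCheck p a N m v X₀ X₁ X₂ = true) : x ∈ primeOf φ := by
  simp only [memCheck, Bool.and_eq_true, Bool.not_eq_true', decide_eq_true_eq,
    decide_eq_false_iff_not] at hc
  obtain ⟨⟨hvN, hm⟩, hXa⟩ := hc
  have hp1 : (1 : ℝ) < p := by exact_mod_cast hp.out.one_lt
  have hp0 : (0 : ℝ) < p := by positivity
  set Q : ℤ_[p] := (X₀ : ℤ_[p]) + (X₁ : ℤ_[p]) * z + (X₂ : ℤ_[p]) * z ^ 2 with hQ
  -- ‖Q‖ ≤ p^(-(v+1))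
  have hQa : ‖((quadEval X₀ X₁ X₂ a : ℤ) : ℤ_[p])‖ ≤ (p : ℝ) ^ (-((v + 1 : ℕ) : ℤ)) :=
    PadicInt.norm_int_le_pow_iff_dvd.mpr hXa
  have hdiff : ‖Q - ((quadEval X₀ X₁ X₂ a : ℤ) : ℤ_[p])‖ ≤ (p : ℝ) ^ (-((v + 1 : ℕ) : ℤ)) := by
    refine (norm_quad_sub_le z a X₀ X₁ X₂).trans (hza.trans ?_)
    apply zpow_le_zpow_right₀ hp1.le; push_cast; omega
  have hQle : ‖Q‖ ≤ (p : ℝ) ^ (-((v + 1 : ℕ) : ℤ)) := by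
    have : Q = (Q - ((quadEval X₀ X₁ X₂ a : ℤ) : ℤ_[p])) + ((quadEval X₀ X₁ X₂ a : ℤ) : ℤ_[p]) := by ring
    rw [this]
    exact (PadicInt.nonarchimedean _ _).trans (max_le hdiff hQa)
  -- ‖m‖ > p^(-(v+1))
  have hmgt : (p : ℝ) ^ (-((v + 1 : ℕ) : ℤ)) < ‖((m : ℤ) : ℤ_[p])‖ := by
    by_contra hle; push Not at hle
    exact hm (PadicInt.norm_int_le_pow_iff_dvd.mp hle)
  have hQm : ‖Q‖ < ‖((m : ℤ) : ℤ_[p])‖ := lt_of_le_of_lt hQle hmgt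
  -- conclude
  rw [mem_primeOf_iff]
  have hmul := emb_mul_eq hθ φ hφ hx
  have hm0 : (m : ℚ_[p]) ≠ 0 := by
    intro h0
    have : ‖((m : ℤ) : ℤ_[p])‖ = 0 := by
      rw [PadicInt.norm_def, PadicInt.coe_intCast, h0, norm_zero]
    rw [this] at hmgt
    exact absurd hmgt (not_lt.mpr (zpow_pos hp0 _).le)
  have hφx : φ x = (Q : ℚ_[p]) / (m : ℚ_[p]) := by
    rw [eq_div_iff hm0, mul_comm]; exact hmul
  rw [hφx, norm_div]
  have hmQ : ‖((m : ℤ) : ℤ_[p])‖ = ‖(m : ℚ_[p])‖ := by rw [PadicInt.norm_def, PadicInt.coe_intCast]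
  rw [← hmQ, div_lt_one (lt_of_le_of_lt (norm_nonneg _) hQm)]
  exact hQm

/-- **Non-membership** `x ∉ P_φ` from the certificate. [folklore] -/
theorem not_mem_primeOf_of_notMemCheck (hθ : aeval θ (MonicCubic.poly A B C) = 0) (φ : K →+* ℚ_[p])
    {z : ℤ_[p]} (hφ : φ θ = (z : ℚ_[p])) {a : ℤ} {N : ℕ} (hza : ‖z - (a : ℤ_[p])‖ ≤ (p : ℝ) ^ (-(N : ℤ)))
    {m : ℤ} {v : ℕ} {X₀ X₁ X₂ : ℤ} {x : 𝓞 K} (hx : (m : 𝓞 K) * x = TwoDescCubic.lin hθ X₀ X₁ X₂)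
    (hc : notMemCheck p a N m v X₀ X₁ X₂ = true) : x ∉ primeOf φ := by
  simp only [notMemCheck, Bool.and_eq_true, Bool.not_eq_true', decide_eq_true_eq,
    decide_eq_false_iff_not] at hc
  obtain ⟨⟨hvN, hm⟩, hXa⟩ := hc
  have hp1 : (1 : ℝ) < p := by exact_mod_cast hp.out.one_lt
  have hp0 : (0 : ℝ) < p := by positivity
  set Q : ℤ_[p] := (X₀ : ℤ_[p]) + (X₁ : ℤ_[p]) * z + (X₂ : ℤ_[p]) * z ^ 2 with hQ
  -- ‖X(a)‖ ≥ p^(-v)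
  have hQa : (p : ℝ) ^ (-(v : ℤ)) ≤ ‖((quadEval X₀ X₁ X₂ a : ℤ) : ℤ_[p])‖ := by
    by_contra hlt; push Not at hlt
    have hle : ‖((quadEval X₀ X₁ X₂ a : ℤ) : ℤ_[p])‖ ≤ (p : ℝ) ^ (-((v + 1 : ℕ) : ℤ)) := by
      rw [PadicInt.norm_le_pow_iff_norm_lt_pow_add_one]
      have : (-((v + 1 : ℕ) : ℤ)) + 1 = -(v : ℤ) := by push_cast; ring
      rw [this]; exact hlt
    exact hXa (PadicInt.norm_int_le_pow_iff_dvd.mp hle)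
  have hlt' : (p : ℝ) ^ (-((v + 1 : ℕ) : ℤ)) < (p : ℝ) ^ (-(v : ℤ)) := by
    apply zpow_lt_zpow_right₀ hp1; push_cast; omega
  have hdiff : ‖Q - ((quadEval X₀ X₁ X₂ a : ℤ) : ℤ_[p])‖ < ‖((quadEval X₀ X₁ X₂ a : ℤ) : ℤ_[p])‖ := by
    refine lt_of_le_of_lt ((norm_quad_sub_le z a X₀ X₁ X₂).trans (hza.trans ?_)) (lt_of_lt_of_le hlt' hQa)
    apply zpow_le_zpow_right₀ hp1.le; push_cast; omega
  have hQeq : ‖Q‖ = ‖((quadEval X₀ X₁ X₂ a : ℤ) : ℤ_[p])‖ := by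
    have : Q = ((quadEval X₀ X₁ X₂ a : ℤ) : ℤ_[p]) + (Q - ((quadEval X₀ X₁ X₂ a : ℤ) : ℤ_[p])) := by ring
    rw [this, PadicInt.norm_add_eq_max_of_ne (ne_of_gt hdiff), max_eq_left hdiff.le]
  -- ‖m‖ ≤ p^(-v)
  have hmle : ‖((m : ℤ) : ℤ_[p])‖ ≤ (p : ℝ) ^ (-(v : ℤ)) := PadicInt.norm_int_le_pow_iff_dvd.mpr hm
  have hmQ' : ‖((m : ℤ) : ℤ_[p])‖ ≤ ‖Q‖ := hmle.trans (hQeq ▸ hQa)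
  have hQpos : 0 < ‖Q‖ := lt_of_lt_of_le (zpow_pos hp0 _) (hQeq ▸ hQa)
  -- conclude
  rw [mem_primeOf_iff, not_lt]
  have hmul := emb_mul_eq hθ φ hφ hx
  have hmQ : ‖((m : ℤ) : ℤ_[p])‖ = ‖(m : ℚ_[p])‖ := by rw [PadicInt.norm_def, PadicInt.coe_intCast]
  have hm0 : (m : ℚ_[p]) ≠ 0 := by
    intro h0
    rw [h0, zero_mul] at hmul
    have : ‖Q‖ = 0 := by rw [PadicInt.norm_def, ← hmul, norm_zero]
    exact absurd this hQpos.ne'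
  have hφx : φ x = (Q : ℚ_[p]) / (m : ℚ_[p]) := by
    rw [eq_div_iff hm0, mul_comm]; exact hmul
  rw [hφx, norm_div, ← hmQ, one_le_div (lt_of_le_of_ne (norm_nonneg _) (fun h => hm0 ?_))]
  · exact hmQ'
  · rw [hmQ] at h; exact norm_eq_zero.mp h.symm

end Mem

end Summit.BirchSwinnertonDyer.BirchSwinnertonDyer.Rank2Observatory.TwoDescPadic
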